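/-
Copyright (c) 2026 the pub-hodgecm-mathlib formalisation cell (harness21).  Prover seat hodgecm-mathlib-K2E3-p26 (g0), Track B «K2-LIT» ∕ h413
(`stmt-HodgeConjecture-24833`), line `K2_E3_EllipticInputs`, unit U4 «Keys», cell «U4-RAM» (dealer K2E3-plan (g4) L4∕E3 EMIT #5), PART «U4Keys» socket :155
`sig_K2E3KeysThmTwoContractingRamifiedCharOneDepthZeroNormTrivial` (depth 0, Branch B), plan step Z3-a (cell functions), CM DRESS.  2026-09-04.
-/
import Summits.HodgeConjecture.HodgeConjecture.Theorems.K2E3BranchBCellGeometry      -- ★ Z3-a FILE 1 p861552 (this seat): place-model cell geometry (`exists_weylLongU_mul_eq`, regions vs `I`)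
import Summits.HodgeConjecture.HodgeConjecture.Theorems.K2E3BranchALettersCM         -- ★ Z2A-3c (i) (K2E3-p06 (g4)): the (G3) frame, `symm_mem_P_of_mem_borelU`, `symm_mem_of_mem_inf`; brings ★ Z2A-3b
                                                                                      --   `K2E3DepthZeroIwahoriCharacterCM.map_weyl_eq_weylLongU ∕ map_mem_unipotentU_of_mem ∕ map_mem_inf_of_mem ∕ coe_eA_apply`
import Summits.HodgeConjecture.HodgeConjecture.Theorems.K2E3IwahoriPlaneTwoCells       -- ★ Z2 (K2E3-p06 (g4)): `toFun_mul_mul_eq_of_eigen`; brings ★ Z2-gen `K2E3TypeVectorSupport.toFun_mul_eq_of_eigen`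
import HarnessLib

/-!
# K2 ∕ E3 «EllipticInputs», unit U4 «Keys» — socket :155 (depth 0, Branch B), step Z3-a, CM DRESS: THE CELL FUNCTIONS OF AN `(I, θ)`-EIGEN-SECTION OF `Ind_P^G τ` ON
# `G = U(Φ₃)(L⁺_v)` ALONG `w₀ · N` AND `w₀ · N · w₀` — regions and explicit factors transported from the place model along `eA`

Cell hodgecm-mathlib (D-0151), FLOOR 0, Track B «K2-LIT», engine E3, crux item H413 = stmt-HodgeConjecture-24833 (route `HCCMUnconditional`, no route verbs); target BY NAME the
OPEN socket `…U4Keys.sig_K2E3KeysThmTwoContractingRamifiedCharOneDepthZeroNormTrivial` (:155; BRANCH B of design D-I v2 of K2E3-p06 (g4)), plan step Z3-a of `PAPER-Z3-DepthZeroInert` §0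
(«cell functions»), CM half.  Author K2E3-p26 (g0) (second hand of cell «U4-RAM», co-hand K2E3-p32 (g0)).  `--supports stmt-HodgeConjecture-24833 --as helper`; THEOREMS ONLY
(no `def`, no `instance`, no notation, no named-fact hypothesis, no `sorry`).  NOT THE PAYER.

THE FRAME is the (G3)-explicit frame of ★ Road II ∕ ★ Z2A-3b∕c VERBATIM: `(w hw eA heA ϖ hϖ g₁ hg₁ K0 K1 I hK0 hK1 hI t ht w₀ hw₀)` — `eA : U(Φ₃)(L⁺_v) ≃ U(Φ₃)(L_w)` the one-place model at the
non-split `v`, `I = K₀ ⊓ K₁` the Iwahori pulled back along `eA`, `t = cmBorelTriple L 3 v` (`P = B`, `N`), `w₀` the element with matrix `Φ₃` (`eA w₀ = w`, ★ `map_weyl_eq_weylLongU`).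
For `u ∈ N(L⁺_v)` write `eA u = u(x, z)` (`x, z ∈ L_w`, `z + σz + xσx = 0`, §0).  THIS FILE transports ★ FILE 1 (place model) along `eA`:
* §1 `mem_iff_v_le_one` — `u ∈ I ⟺ |z|_w ≤ 1` (the region `N₀ = N ∩ I`).
* §2 **`exists_eq_mul_of_one_lt_v`** — for `|z|_w > 1`: `w₀ · u = p · κ` with `p ∈ P`, `κ ∈ I`, `eA p = [[(σz)⁻¹, −x∕z, 1],[0, −σz∕z, −σx],[0,0,z]]`, `eA κ = ū(x∕z, 1∕z)` (so `κ₀₀ = 1`).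
* §3 **`exists_conj_eq_mul_of_one_le_v`** — for `|z|_w ≥ 1`: `w₀ · u · w₀ = p · w₀ · n₂` with the same `p` and `n₂ ∈ I`, `eA n₂ = u(x∕z, 1∕z)`.
* §4 `conj_mem_iff_v_lt_one` — `w₀ · u · w₀ ∈ I ⟺ |z|_w < 1` (the region `N̄₁`).
* §5 the four POINTWISE CELL VALUES of an `(I, θ)`-eigen-section `f` of `Ind_P^G τ` (`τ` ANY one-dimensional representation of `P`, `θ : G → ℂ` ANY function; ★ Z2-gen ∕ ★ Z2 evaluation):
  `f(w₀u) = θ(u)·f(w₀)` on `N₀`; `f(w₀u) = τ(p)·θ(κ)·f(1)` off `N₀`; `f(w₀uw₀) = θ(w₀uw₀)·f(1)` on `|z| < 1`; `f(w₀uw₀) = τ(p)·θ(n₂)·f(w₀)` on `|z| ≥ 1` — with `τ(p)`, `θ(κ) = θ(n₂) = 1` (depth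
  0: `κ₀₀ = (n₂)₀₀ = 1`) left to the consumer (Z3-c: `τ(p) = χ₁(σz)⁻¹‖z‖_w⁻¹` by ★ `twist_comp_proj_apply_one` ∕ ★ `theta_eq_chi_torusEntry_proj`, `‖·‖` by ★ `rootDeltaChar_cmBorel_eq_unitModulusChar`).
These are EXACTLY the integrands of the Casselman pair `Λ_1 f_w = vol N₀ · f_w(w₀)`, `Λ_{w₀} f₁ = vol N(𝔭) · f₁(1)`, `G₁ = Λ_1 f₁`, `G₂ = Λ_{w₀} f_w` of `PAPER-Z3` §1 for the normalised type basis
`(f₁, f_w)` of ★ p861529 `K2E3IwahoriTypeBasisMackey` (K2E3-p32 (g0)).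

HONEST LABEL: HC_CM is proved only modulo the 7 printed citations (2 remaining named inputs: hLiu418 = stmt-HodgeConjecture-24832, h413 = stmt-HodgeConjecture-24833)
until rung 0 closes; count-neutral — this file does NOT pay the socket; no printed citation is discharged.

## References
* [BruhatTits1972] F. Bruhat, J. Tits, *Groupes réductifs sur un corps local I*, Publ. Math. IHÉS 41 (1972), (4.4.3)–(4.4.4).
* [Casselman1995] W. Casselman, *Introduction to the theory of admissible representations of `p`-adic reductive groups* (1995), Prop. 1.3.1, §3.3, §6.4.
* [Rogawski1990] J. Rogawski, *Automorphic representations of unitary groups in three variables*, Ann. of Math. Stud. 123 (1990), §1.10 p. 9, §12.1 p. 171.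
* [Keys1984] D. Keys, *Principal series representations of special unitary groups over local fields*, Compositio Math. 51 (1984), §7.
* [PlatonovRapinchuk1994] V. Platonov, A. Rapinchuk, *Algebraic Groups and Number Theory* (1994), §5.1 (`G(L ⊗ L⁺_v) = G(L_w)` at a non-split place).
-/

set_option autoImplicit false
-- the mandated namespace has the single-problem summit's repeated segment (`HodgeConjecture.HodgeConjecture`)
set_option linter.dupNamespace false

noncomputable section

open NumberField IsDedekindDomain
open scoped Matrix MatrixGroups WithZero Valued
open Literature.NumberTheory Literature.NumberTheory.Automorphic Literature.NumberTheory.Automorphic.UnitaryGroup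
open Literature.NumberTheory.Rogawski1990

namespace Summit.HodgeConjecture.HodgeConjecture.Cruxes.H413.K2E3BranchBCellFunctionsCM

open Summit.HodgeConjecture.HodgeConjecture.Cruxes.H413 Summit.HodgeConjecture.HodgeConjecture.Cruxes.H413.K2E3DepthZeroIwahoriCharacterCM
open Summit.HodgeConjecture.HodgeConjecture.Cruxes.H413.K2E3BranchALettersCM

variable (L : Type) [Field L] [NumberField L] [IsCMField L] (v : HeightOneSpectrum (𝓞 ↥(maximalRealSubfield L)))
  (w : PlacesOver L v) (hw : IsCMField.complexConj L • w.1 = w.1)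
  (eA : Gqs L v ≃ₜ* ↥(unitaryGroupOfForm (galAdicCompletionMap (L := L) (IsCMField.complexConj L) hw) ((StdForm.antidiagonal 3).over (w.1.adicCompletion L))))
  (heA : ∀ g : Gqs L v,
    ((eA g : ↥(unitaryGroupOfForm (galAdicCompletionMap (L := L) (IsCMField.complexConj L) hw) ((StdForm.antidiagonal 3).over (w.1.adicCompletion L)))) :
        GL (Fin 3) (w.1.adicCompletion L)) =
      ((localNonsplitEquiv (IsCMField.complexConj L) (qsForm L) (IsCMField.complexConj_ne_one L) w hw g :
        ↥(unitaryGroupOfForm (galAdicCompletionMap (L := L) (IsCMField.complexConj L) hw) (placeForm (qsForm L) w.1))) : GL (Fin 3) (w.1.adicCompletion L)))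
  {ϖ : w.1.adicCompletion L} (hϖ : Valued.v ϖ = WithZero.exp (-1 : ℤ))
  (g₁ : GL (Fin 3) (w.1.adicCompletion L)) (hg₁ : (g₁ : Matrix (Fin 3) (Fin 3) (w.1.adicCompletion L)) = Matrix.diagonal ![(1 : w.1.adicCompletion L), 1, ϖ])
  (K0 K1 I : Subgroup (Gqs L v))
  (hK0 : K0 = ((glInt 3 (w.1.adicCompletion L)).subgroupOf
    (unitaryGroupOfForm (galAdicCompletionMap (L := L) (IsCMField.complexConj L) hw) ((StdForm.antidiagonal 3).over (w.1.adicCompletion L)))).comap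
      eA.toMulEquiv.toMonoidHom)
  (hK1 : K1 = (((glInt 3 (w.1.adicCompletion L)).map (MulAut.conj g₁).toMonoidHom).subgroupOf
    (unitaryGroupOfForm (galAdicCompletionMap (L := L) (IsCMField.complexConj L) hw) ((StdForm.antidiagonal 3).over (w.1.adicCompletion L)))).comap
      eA.toMulEquiv.toMonoidHom)
  (hI : I = K0 ⊓ K1)
  (t : ParabolicTriple (Gqs L v)) (ht : t = cmBorelTriple L 3 v)
  (w₀ : Gqs L v) (hw₀ : Units.val (w₀.val : GL (Fin 3) (LocalRing L v)) = cmLocalForm L 3 v)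

/-! ## §0 `eA u = u(x, z)` for `u ∈ N(L⁺_v)` -/

include heA ht in
/-- **`eA u = u(x, z)`** for `u ∈ N(L⁺_v)`: the image in the place model is upper unitriangular of the shape `[[1,x,z],[0,1,−σx],[0,0,1]]` with `z + σz + xσx = 0` (★ Z2A-3b
`map_mem_unipotentU_of_mem`, ★ `exists_coe_eq_upper_of_mem_unipotentU`). [cite: Rogawski1990, §1.10 p. 9] [cite: PlatonovRapinchuk1994, §5.1] -/
theorem exists_coe_eA_eq_upper {u : Gqs L v} (hu : u ∈ t.N) :
    ∃ x z : w.1.adicCompletion L,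
      (((eA u : ↥(unitaryGroupOfForm (galAdicCompletionMap (L := L) (IsCMField.complexConj L) hw) ((StdForm.antidiagonal 3).over (w.1.adicCompletion L)))) :
          GL (Fin 3) (w.1.adicCompletion L)) : Matrix (Fin 3) (Fin 3) (w.1.adicCompletion L)) =
        !![1, x, z; 0, 1, -galAdicCompletionMap (L := L) (IsCMField.complexConj L) hw x; 0, 0, 1] ∧
      z + galAdicCompletionMap (L := L) (IsCMField.complexConj L) hw z + x * galAdicCompletionMap (L := L) (IsCMField.complexConj L) hw x = 0 :=
  exists_coe_eq_upper_of_mem_unipotentU _ rfl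
    (galAdicCompletionMap_galAdicCompletionMap_of_smul_eq (IsCMField.complexConj L) w (IsCMField.complexConj_ne_one L) hw)
    (map_mem_unipotentU_of_mem L v w hw eA heA t ht hu)

/-! ## §1 The region `N₀ = N ∩ I`: `u ∈ I ⟺ |z|_w ≤ 1` -/

include hϖ hg₁ hK0 hK1 hI in
/-- **`u ∈ I ⟺ |z|_w ≤ 1`** for `u ∈ N(L⁺_v)` with `eA u = u(x, z)` (★ FILE 1 `mem_inf_iff_v_le_one` pulled back along `eA`). [cite: BruhatTits1972, (4.4.4)] [cite: Rogawski1990, §1.10 p. 9] -/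
theorem mem_iff_v_le_one {u : Gqs L v} {x z : w.1.adicCompletion L}
    (hux : (((eA u : ↥(unitaryGroupOfForm (galAdicCompletionMap (L := L) (IsCMField.complexConj L) hw) ((StdForm.antidiagonal 3).over (w.1.adicCompletion L)))) :
          GL (Fin 3) (w.1.adicCompletion L)) : Matrix (Fin 3) (Fin 3) (w.1.adicCompletion L)) =
        !![1, x, z; 0, 1, -galAdicCompletionMap (L := L) (IsCMField.complexConj L) hw x; 0, 0, 1])
    (hrel : z + galAdicCompletionMap (L := L) (IsCMField.complexConj L) hw z + x * galAdicCompletionMap (L := L) (IsCMField.complexConj L) hw x = 0) :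
    u ∈ I ↔ Valued.v z ≤ 1 := by
  have hvσ : ∀ y, Valued.v (galAdicCompletionMap (L := L) (IsCMField.complexConj L) hw y) = Valued.v y :=
    fun y => valued_galAdicCompletionMap (L := L) (IsCMField.complexConj L) hw y
  have key := K2E3BranchBCellGeometry.mem_inf_iff_v_le_one _ rfl hvσ hϖ g₁ hg₁ hux hrel
  constructor
  · exact fun hu => key.1 (map_mem_inf_of_mem L v w hw eA g₁ K0 K1 I hK0 hK1 hI hu)
  · intro hz
    have h := symm_mem_of_mem_inf L v w hw eA g₁ K0 K1 I hK0 hK1 hI (key.2 hz)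
    rwa [ContinuousMulEquiv.symm_apply_apply] at h

/-! ## §2 The far region `|z|_w > 1`: `w₀ · u = p · κ` (cell `P · I`) -/

include hw heA hϖ hg₁ hK0 hK1 hI ht hw₀ in
/-- **`w₀ · u = p · κ` with `p ∈ P`, `κ ∈ I` for `|z|_w > 1`** (★ FILE 1 `exists_weylLongU_mul_eq` + `lower_mem_inf_of_one_lt_v` at `eA u`, pulled back: `eA⁻¹(B) ⊆ P` ★ `symm_mem_P_of_mem_borelU`,
`eA⁻¹(I_w) = I` ★ `symm_mem_of_mem_inf`, `eA w₀ = w` ★ `map_weyl_eq_weylLongU`), with the place matrices of `p` (diagonal `((σz)⁻¹, −σz∕z, z)`) and `κ = ū(x∕z, 1∕z)` (`κ₀₀ = 1`).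
[cite: Rogawski1990, §1.10 p. 9] [cite: Casselman1995, Prop. 1.3.1] [cite: Keys1984, §7] -/
theorem exists_eq_mul_of_one_lt_v {u : Gqs L v} {x z : w.1.adicCompletion L}
    (hux : (((eA u : ↥(unitaryGroupOfForm (galAdicCompletionMap (L := L) (IsCMField.complexConj L) hw) ((StdForm.antidiagonal 3).over (w.1.adicCompletion L)))) :
          GL (Fin 3) (w.1.adicCompletion L)) : Matrix (Fin 3) (Fin 3) (w.1.adicCompletion L)) =
        !![1, x, z; 0, 1, -galAdicCompletionMap (L := L) (IsCMField.complexConj L) hw x; 0, 0, 1])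
    (hrel : z + galAdicCompletionMap (L := L) (IsCMField.complexConj L) hw z + x * galAdicCompletionMap (L := L) (IsCMField.complexConj L) hw x = 0)
    (hz : 1 < Valued.v z) :
    ∃ p ∈ t.P, ∃ κ ∈ I, w₀ * u = p * κ ∧
      (((eA p : ↥(unitaryGroupOfForm (galAdicCompletionMap (L := L) (IsCMField.complexConj L) hw) ((StdForm.antidiagonal 3).over (w.1.adicCompletion L)))) :
          GL (Fin 3) (w.1.adicCompletion L)) : Matrix (Fin 3) (Fin 3) (w.1.adicCompletion L)) =
        !![(galAdicCompletionMap (L := L) (IsCMField.complexConj L) hw z)⁻¹, -(x * z⁻¹), 1;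
           0, -(galAdicCompletionMap (L := L) (IsCMField.complexConj L) hw z * z⁻¹), -galAdicCompletionMap (L := L) (IsCMField.complexConj L) hw x;
           0, 0, z] ∧
      (((eA κ : ↥(unitaryGroupOfForm (galAdicCompletionMap (L := L) (IsCMField.complexConj L) hw) ((StdForm.antidiagonal 3).over (w.1.adicCompletion L)))) :
          GL (Fin 3) (w.1.adicCompletion L)) : Matrix (Fin 3) (Fin 3) (w.1.adicCompletion L)) =
        !![1, 0, 0;
           -(galAdicCompletionMap (L := L) (IsCMField.complexConj L) hw x * (galAdicCompletionMap (L := L) (IsCMField.complexConj L) hw z)⁻¹), 1, 0;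
           z⁻¹, x * z⁻¹, 1] := by
  have hσσ : ∀ y, (galAdicCompletionMap (L := L) (IsCMField.complexConj L) hw) ((galAdicCompletionMap (L := L) (IsCMField.complexConj L) hw) y) = y :=
    galAdicCompletionMap_galAdicCompletionMap_of_smul_eq (IsCMField.complexConj L) w (IsCMField.complexConj_ne_one L) hw
  have hvσ : ∀ y, Valued.v (galAdicCompletionMap (L := L) (IsCMField.complexConj L) hw y) = Valued.v y :=
    fun y => valued_galAdicCompletionMap (L := L) (IsCMField.complexConj L) hw y
  have hz0 : z ≠ 0 := fun h => by rw [h, map_zero] at hz; exact not_lt_of_ge zero_le_one hz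
  obtain ⟨p, κ, hfac, hp, hκ⟩ := K2E3BranchBCellGeometry.exists_weylLongU_mul_eq _ rfl hσσ hux hrel hz0
  refine ⟨eA.symm p, symm_mem_P_of_mem_borelU L v w hw eA heA t ht (K2E3BranchBCellGeometry.mem_borelU_of_coe_eq _ hp), eA.symm κ,
    symm_mem_of_mem_inf L v w hw eA g₁ K0 K1 I hK0 hK1 hI (K2E3BranchBCellGeometry.lower_mem_inf_of_one_lt_v _ rfl hvσ hϖ g₁ hg₁ hκ hrel hz), ?_, ?_, ?_⟩
  · apply eA.injective
    rw [map_mul, map_mul, ContinuousMulEquiv.apply_symm_apply, ContinuousMulEquiv.apply_symm_apply, map_weyl_eq_weylLongU L v w hw eA heA w₀ hw₀, hfac]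
  · rw [ContinuousMulEquiv.apply_symm_apply]; exact hp
  · rw [ContinuousMulEquiv.apply_symm_apply]; exact hκ

/-! ## §3 `|z|_w ≥ 1`: `w₀ · u · w₀ = p · w₀ · n₂` (cell `P · w₀ · I`) -/

include hw heA hϖ hg₁ hK0 hK1 hI ht hw₀ in
/-- **`w₀ · u · w₀ = p · w₀ · n₂` with `p ∈ P`, `n₂ ∈ I` for `|z|_w ≥ 1`** (★ FILE 1 `exists_weylLongU_mul_mul_weylLongU_eq` + `upper_mem_inf_of_one_le_v` at `eA u`, pulled back along `eA`), with
the place matrices of `p` and `n₂ = u(x∕z, 1∕z)` (`(n₂)₀₀ = 1`). [cite: Rogawski1990, §1.10 p. 9] [cite: Casselman1995, Prop. 1.3.1] [cite: Keys1984, §7] -/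
theorem exists_conj_eq_mul_of_one_le_v {u : Gqs L v} {x z : w.1.adicCompletion L}
    (hux : (((eA u : ↥(unitaryGroupOfForm (galAdicCompletionMap (L := L) (IsCMField.complexConj L) hw) ((StdForm.antidiagonal 3).over (w.1.adicCompletion L)))) :
          GL (Fin 3) (w.1.adicCompletion L)) : Matrix (Fin 3) (Fin 3) (w.1.adicCompletion L)) =
        !![1, x, z; 0, 1, -galAdicCompletionMap (L := L) (IsCMField.complexConj L) hw x; 0, 0, 1])
    (hrel : z + galAdicCompletionMap (L := L) (IsCMField.complexConj L) hw z + x * galAdicCompletionMap (L := L) (IsCMField.complexConj L) hw x = 0)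
    (hz : 1 ≤ Valued.v z) :
    ∃ p ∈ t.P, ∃ n₂ ∈ I, w₀ * u * w₀ = p * w₀ * n₂ ∧
      (((eA p : ↥(unitaryGroupOfForm (galAdicCompletionMap (L := L) (IsCMField.complexConj L) hw) ((StdForm.antidiagonal 3).over (w.1.adicCompletion L)))) :
          GL (Fin 3) (w.1.adicCompletion L)) : Matrix (Fin 3) (Fin 3) (w.1.adicCompletion L)) =
        !![(galAdicCompletionMap (L := L) (IsCMField.complexConj L) hw z)⁻¹, -(x * z⁻¹), 1;
           0, -(galAdicCompletionMap (L := L) (IsCMField.complexConj L) hw z * z⁻¹), -galAdicCompletionMap (L := L) (IsCMField.complexConj L) hw x;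
           0, 0, z] ∧
      (((eA n₂ : ↥(unitaryGroupOfForm (galAdicCompletionMap (L := L) (IsCMField.complexConj L) hw) ((StdForm.antidiagonal 3).over (w.1.adicCompletion L)))) :
          GL (Fin 3) (w.1.adicCompletion L)) : Matrix (Fin 3) (Fin 3) (w.1.adicCompletion L)) =
        !![1, x * z⁻¹, z⁻¹;
           0, 1, -(galAdicCompletionMap (L := L) (IsCMField.complexConj L) hw x * (galAdicCompletionMap (L := L) (IsCMField.complexConj L) hw z)⁻¹);
           0, 0, 1] := by
  have hσσ : ∀ y, (galAdicCompletionMap (L := L) (IsCMField.complexConj L) hw) ((galAdicCompletionMap (L := L) (IsCMField.complexConj L) hw) y) = y :=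
    galAdicCompletionMap_galAdicCompletionMap_of_smul_eq (IsCMField.complexConj L) w (IsCMField.complexConj_ne_one L) hw
  have hvσ : ∀ y, Valued.v (galAdicCompletionMap (L := L) (IsCMField.complexConj L) hw y) = Valued.v y :=
    fun y => valued_galAdicCompletionMap (L := L) (IsCMField.complexConj L) hw y
  have hz0 : z ≠ 0 := fun h => by rw [h, map_zero] at hz; exact not_le_of_gt zero_lt_one hz
  obtain ⟨p, n₂, hfac, hp, hn₂⟩ := K2E3BranchBCellGeometry.exists_weylLongU_mul_mul_weylLongU_eq _ rfl hσσ hux hrel hz0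
  refine ⟨eA.symm p, symm_mem_P_of_mem_borelU L v w hw eA heA t ht (K2E3BranchBCellGeometry.mem_borelU_of_coe_eq _ hp), eA.symm n₂,
    symm_mem_of_mem_inf L v w hw eA g₁ K0 K1 I hK0 hK1 hI (K2E3BranchBCellGeometry.upper_mem_inf_of_one_le_v _ rfl hvσ hϖ g₁ hg₁ hn₂ hrel hz), ?_, ?_, ?_⟩
  · apply eA.injective
    rw [map_mul, map_mul, map_mul, map_mul, ContinuousMulEquiv.apply_symm_apply, ContinuousMulEquiv.apply_symm_apply, map_weyl_eq_weylLongU L v w hw eA heA w₀ hw₀,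
      hfac]
  · rw [ContinuousMulEquiv.apply_symm_apply]; exact hp
  · rw [ContinuousMulEquiv.apply_symm_apply]; exact hn₂

/-! ## §4 The region `N̄₁ = N̄ ∩ I`: `w₀ · u · w₀ ∈ I ⟺ |z|_w < 1` -/

include heA hw₀ in
/-- **`eA (w₀ · u · w₀) = ū(x, z) = [[1,0,0],[−σx,1,0],[z,x,1]]`** (★ FILE 1 `coe_weylLongU_mul_mul_weylLongU` through `eA w₀ = w`). [cite: Rogawski1990, §1.10 p. 9] -/
theorem coe_eA_conj_eq_lower {u : Gqs L v} {x z : w.1.adicCompletion L}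
    (hux : (((eA u : ↥(unitaryGroupOfForm (galAdicCompletionMap (L := L) (IsCMField.complexConj L) hw) ((StdForm.antidiagonal 3).over (w.1.adicCompletion L)))) :
          GL (Fin 3) (w.1.adicCompletion L)) : Matrix (Fin 3) (Fin 3) (w.1.adicCompletion L)) =
        !![1, x, z; 0, 1, -galAdicCompletionMap (L := L) (IsCMField.complexConj L) hw x; 0, 0, 1]) :
    (((eA (w₀ * u * w₀) : ↥(unitaryGroupOfForm (galAdicCompletionMap (L := L) (IsCMField.complexConj L) hw) ((StdForm.antidiagonal 3).over (w.1.adicCompletion L)))) :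
        GL (Fin 3) (w.1.adicCompletion L)) : Matrix (Fin 3) (Fin 3) (w.1.adicCompletion L)) =
      !![1, 0, 0; -galAdicCompletionMap (L := L) (IsCMField.complexConj L) hw x, 1, 0; z, x, 1] := by
  rw [map_mul, map_mul, map_weyl_eq_weylLongU L v w hw eA heA w₀ hw₀]
  exact K2E3BranchBCellGeometry.coe_weylLongU_mul_mul_weylLongU _ rfl hux

include heA hϖ hg₁ hK0 hK1 hI hw₀ in
/-- **`w₀ · u · w₀ ∈ I ⟺ |z|_w < 1`** for `u ∈ N(L⁺_v)` with `eA u = u(x, z)` (★ FILE 1 `lower_mem_inf_iff_v_lt_one` pulled back along `eA`). [cite: BruhatTits1972, (4.4.4)]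
[cite: Casselman1995, Prop. 1.4.4] -/
theorem conj_mem_iff_v_lt_one {u : Gqs L v} {x z : w.1.adicCompletion L}
    (hux : (((eA u : ↥(unitaryGroupOfForm (galAdicCompletionMap (L := L) (IsCMField.complexConj L) hw) ((StdForm.antidiagonal 3).over (w.1.adicCompletion L)))) :
          GL (Fin 3) (w.1.adicCompletion L)) : Matrix (Fin 3) (Fin 3) (w.1.adicCompletion L)) =
        !![1, x, z; 0, 1, -galAdicCompletionMap (L := L) (IsCMField.complexConj L) hw x; 0, 0, 1])
    (hrel : z + galAdicCompletionMap (L := L) (IsCMField.complexConj L) hw z + x * galAdicCompletionMap (L := L) (IsCMField.complexConj L) hw x = 0) :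
    w₀ * u * w₀ ∈ I ↔ Valued.v z < 1 := by
  have hvσ : ∀ y, Valued.v (galAdicCompletionMap (L := L) (IsCMField.complexConj L) hw y) = Valued.v y :=
    fun y => valued_galAdicCompletionMap (L := L) (IsCMField.complexConj L) hw y
  have key := K2E3BranchBCellGeometry.lower_mem_inf_iff_v_lt_one _ rfl hvσ hϖ g₁ hg₁ (coe_eA_conj_eq_lower L v w hw eA heA w₀ hw₀ hux) hrel
  constructor
  · exact fun hu => key.1 (map_mem_inf_of_mem L v w hw eA g₁ K0 K1 I hK0 hK1 hI hu)
  · intro hz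
    have h := symm_mem_of_mem_inf L v w hw eA g₁ K0 K1 I hK0 hK1 hI (key.2 hz)
    rwa [ContinuousMulEquiv.symm_apply_apply] at h

/-! ## §5 The four cell values of an `(I, θ)`-eigen-section -/

section CellValues

variable (τ : Representation ℂ ↥t.P ℂ) (θ : Gqs L v → ℂ) (f : Representation.SmoothInd t.P τ)
  (heig : ∀ b ∈ I, Representation.smoothIndRep t.P τ b f = θ b • f)

omit hw in
include heig in
/-- **On `N₀`: `f(w₀ u) = θ(u)·f(w₀)`** (`w₀ u = 1 · w₀ · u`, ★ Z2 `toFun_mul_mul_eq_of_eigen`). [cite: Casselman1995, §3.3] [cite: Keys1984, §7] -/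
theorem toFun_weyl_mul_of_mem {u : Gqs L v} (hu : u ∈ I) : f.toFun (w₀ * u) = θ u * f.toFun w₀ := by
  have h := K2E3IwahoriPlaneTwoCells.toFun_mul_mul_eq_of_eigen t.P τ I θ f heig 1 t.P.one_mem w₀ u hu
  rw [one_mul] at h
  rw [h, show (⟨1, t.P.one_mem⟩ : ↥t.P) = 1 from rfl, MonoidHom.map_one, Module.End.one_apply, one_mul]

omit hw in
include heig in
/-- **Off `N₀` (cell `P · I`): `f(w₀ u) = τ(p)·θ(κ)·f(1)`** for `w₀ u = p κ` (§2; ★ Z2-gen `toFun_mul_eq_of_eigen`). [cite: Casselman1995, §3.3, §6.4] [cite: Keys1984, §7] -/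
theorem toFun_weyl_mul_of_eq_mul {u p κ : Gqs L v} (hp : p ∈ t.P) (hκ : κ ∈ I) (h : w₀ * u = p * κ) :
    f.toFun (w₀ * u) = τ (⟨p, hp⟩ : ↥t.P) 1 * θ κ * f.toFun 1 := by
  rw [h]
  exact K2E3TypeVectorSupport.toFun_mul_eq_of_eigen t.P τ I θ f heig p hp κ hκ

omit hw in
include heig in
/-- **On `N̄₁` (`|z|_w < 1`): `f(w₀ u w₀) = θ(w₀ u w₀)·f(1)`** (`w₀uw₀ = 1 · (w₀uw₀) ∈ P · I`). [cite: Casselman1995, §3.3] [cite: Keys1984, §7] -/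
theorem toFun_conj_of_mem {u : Gqs L v} (hu : w₀ * u * w₀ ∈ I) : f.toFun (w₀ * u * w₀) = θ (w₀ * u * w₀) * f.toFun 1 := by
  have h := K2E3TypeVectorSupport.toFun_mul_eq_of_eigen t.P τ I θ f heig 1 t.P.one_mem (w₀ * u * w₀) hu
  rw [one_mul] at h
  rw [h, show (⟨1, t.P.one_mem⟩ : ↥t.P) = 1 from rfl, MonoidHom.map_one, Module.End.one_apply, one_mul]

omit hw in
include heig in
/-- **On `|z|_w ≥ 1` (cell `P · w₀ · I`): `f(w₀ u w₀) = τ(p)·θ(n₂)·f(w₀)`** for `w₀ u w₀ = p w₀ n₂` (§3; ★ Z2 `toFun_mul_mul_eq_of_eigen`). [cite: Casselman1995, §3.3, §6.4]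
[cite: Keys1984, §7] -/
theorem toFun_conj_of_eq_mul {u p n₂ : Gqs L v} (hp : p ∈ t.P) (hn₂ : n₂ ∈ I) (h : w₀ * u * w₀ = p * w₀ * n₂) :
    f.toFun (w₀ * u * w₀) = τ (⟨p, hp⟩ : ↥t.P) 1 * θ n₂ * f.toFun w₀ := by
  rw [h]
  exact K2E3IwahoriPlaneTwoCells.toFun_mul_mul_eq_of_eigen t.P τ I θ f heig p hp w₀ n₂ hn₂

end CellValues

end Summit.HodgeConjecture.HodgeConjecture.Cruxes.H413.K2E3BranchBCellFunctionsCM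

end
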